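/-
Copyright (c) 2026 the pub-hodgecm-mathlib formalisation cell (harness21).  Prover seat hodgecm-mathlib-LH4-p07 (g4), req620 Track A «(D-RAM) FOUR-FRAME» squad
(heir LEAD F0P3a-plan lineage; dealer LH4-plan lineage; MS ROAD A, Stage B₂ brick B7₂ (i)₂ «CORE-HANGING STRATA, TYPE 2 — THE EXACT POLARISATION SET», FILE (A);
Stage B lead LH4-p10 (g2); re-keyed on multiplicity by LH4-p11 (g2) 2026-09-04T00:53Z).  2026-09-04.
-/
import Summits.HodgeConjecture.HodgeConjecture.Theorems.F0P3cDyRamDiagonalGluedTubeCriterionTypeTwo   -- ★ p856270 (LH4-p09, B5₂ (i)): `isIntMatrix_smul_inv_fin_three`, `v_neg_add_le`, `exists_fixed_of_isTypeTwoPolarisable_latt_hnf_glued`; brings ★ p855737 (`formCongr_hnf_diagonal`, `det_coe_hnf`, `det_formCongr_diagonal`, `single_two_mem_latt_hnf_iff`, `isIntMatrix_of_fin_three`, `v_add_eq_of_lt`), ★ StrataDefs ED. 2 (`IsTypeTwoPolarisable`), ★ `v_sub_le_of_le` &c.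
import Summits.HodgeConjecture.HodgeConjecture.Theorems.F0P3cDyRamDiagonalCoreHangingCriterion        -- ★ p855897 (this seat, B7 (i)): `v_two_le_of_trace_bound`
import Literature.NumberTheory.Automorphic.UnitaryLatticeTreeTubeCoordinate                            -- ★ `v_pow_eq_exp_neg`
import HarnessLib

/-!
# Crux `H413`, MS ROAD A, STAGE B₂ brick B7₂ (i)₂, FILE (A): «CORE-HANGING STRATA, TYPE 2 — THE LETTERS OF A POLARISATION» (necessity)

Cell `hodgecm-mathlib` (D-0151), FLOOR 0, crux item H413 = `stmt-HodgeConjecture-24833`; lane `--supports stmt-HodgeConjecture-24833 --as helper` (count-neutral).  THEOREMS ONLY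
(no `def`, no instance, no notation, no `sorry`, default heartbeats).
THE STRATUM (LH4-p10 (g2) MEMO v2.1 §T2.1 ∕ §T2.3, skeleton₂ `B10-StableCountTypeTwo.SKELETON.v1` 08e5e6e2 `stub_B7_H`, re-keyed on MULTIPLICITY by LH4-p11 (g2)'s ruling
2026-09-04T00:53Z: the head is `∑ᶠ_{M ∈ stratumTwo σ ϖ T (2ρ+1,2ρ+1,2ρ+1)} n₂(M)·w(M)`, `n₂ = polarisationCount σ ϖ 2`): the CORE-HANGING TYPE-2 lattices `H(2ρ+1)` are `M = latt V`,
`V = (1 0 0; x ϖ^ρ 0; xζ + y″ ϖ^ρζ ϖ^{2ρ+1})` with `x, ζ, y″` AND `y = xζ + y″` units, `ρ ≥ 1` — the `s = 0` end of the type-2 glued family of ★ p856270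
`F0P3cDyRamDiagonalGluedTubeCriterionTypeTwo` (which needs `s` even `≥ 2`), i.e. the type-0 core-hanging frame of ★ p855897 with the LAST EXPONENT ONE LARGER.
FILES (A) (this file) and (B) `F0P3cDyRamDiagonalCoreHangingCriterionTypeTwo` determine, for such a `V`, the set `Δ₂(latt V)` of ALL non-degenerate `σ`-fixed diagonal forms `diag D`
of which `latt V` is a type-2 vertex EXACTLY — not only whether it is empty — because the re-keyed head weighs each lattice by the NUMBER of `S_F`-classes in `Δ₂`
(`= q` for even `ρ`, `1` for odd `ρ`).  With the LETTERS `P := D₂`, `f := −(D₁ + D₂·Nζ)∕D₂` (so `D₁ = −P(Nζ + f)`), `g := G₀₀∕D₂ = (D₀ + Nx·D₁ + Ny·D₂)∕D₂`, `B := ζσy″ − σx·f`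
(all `σ`-fixed but `B`), the Gram matrix `G = (σV)ᵀ·diag D·V` (★ `formCongr_hnf_diagonal`) reads `G₀₀ = P·g`, `G₀₁ = ϖ^ρ·P·B`, `G₁₀ = σ(ϖ^ρ)·P·σB`, `G₁₁ = −π₀^ρ·P·f`
(`π₀ = ϖσϖ`), the other five entries in `ϖ^{2ρ+1}·P·𝒪`, and `G₀₀G₁₁ − G₀₁G₁₀ = −π₀^ρ·P²·(f·g + B·σB)`.  TYPE 2 means (★ `isVertexLattice_latt_iff_of_v`): `G` integral, `ϖ·G⁻¹`
integral, `|det G| = |ϖ|²`.  RESULT (A)+(B): `D ∈ Δ₂(latt V)` ⟺ `|P| = |ϖ|^{−2ρ}` ∧ (R) `|B| ≤ |ϖ|^ρ` ∧ (COF) `|f·g + B·σB| ≤ |ϖ|^{2ρ+1}`.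
* §1 `isIntMatrix_smul_inv_fin_three_of_le` — ★ p09's cofactor lemma with the rank-one identity `ae = bd` relaxed to `|ae − bd| ≤ |ϖ|` (the ninth cofactor); and its converse
  `v_cofactor_le_of_isIntMatrix_smul_inv` — `ϖ·G⁻¹` integral with `|det G| = |ϖ|²` puts the `(2,2)` cofactor `G₀₀G₁₁ − G₀₁G₁₀` in `𝔭` (`(ϖG⁻¹)₂₂ = ϖ·C₂₂∕det G`).
* §2 NECESSITY `letters_of_isVertexLattice_two_latt_coreHanging`: `|P|⁻¹ ≤ |ϖ|^{2ρ}` (p09's axis argument: `ϖ·P⁻¹e₃ ∈ ϖM^♯ ⊆ M`), `|P|·|ϖ|^{2ρ+1} ≤ 1` (entry `G₀₂ = σy·P·ϖ^{2ρ+1}`,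
  `y` a unit), (R) (entry `G₀₁`), (COF) (§1 converse).  Over a RAMIFIED datum (`σ`-fixed elements have even valuation, `|ϖ| = exp(−1)`) the two bounds pin `|P| = |ϖ|^{−2ρ}`:
  `v_eq_of_fixed_of_bounds`.
HONEST LABEL.  Count-neutral; the census laws stay PROVER TARGETS until the MS assembly lands; `HC_CM` is proved only modulo the 7 printed citations (2 remaining named inputs:
hLiu418 = `stmt-HodgeConjecture-24832`, h413 = `stmt-HodgeConjecture-24833`) until rung 0 closes.

## References
* [Jacobowitz1962] R. Jacobowitz, *Hermitian forms over local fields*, Amer. J. Math. 84 (1962), §4, §7 (Gram matrices, modular lattices, dual bases).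
* [Kottwitz1986BaseChangeUnits] R. Kottwitz, *Base change for unit elements of Hecke algebras*, Compositio Math. 60 (1986), §1 pp. 240–241 (fixed-lattice counting).
* [Serre1980Trees] J.-P. Serre, *Trees*, Springer (1980), Ch. II §1.1 (lattices `g·𝒪^N`, Hermite normal form).
-/

set_option autoImplicit false

noncomputable section

namespace Summit.HodgeConjecture.HodgeConjecture.Cruxes.H413.F0P3cDyRamDiagonalCoreHangingPolarisationsTypeTwo

open Matrix
open Literature.NumberTheory.Automorphic Literature.NumberTheory.Automorphic.HermitianLattice Literature.NumberTheory.Automorphic.UnitaryGroup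
open Literature.NumberTheory.Automorphic.UnitaryLatticeTree
open Summit.HodgeConjecture.HodgeConjecture.Cruxes.H413.F0P3cDyRamDiagonalTorusDefs
open Summit.HodgeConjecture.HodgeConjecture.Cruxes.H413.F0P3cDyRamDiagonalStableLatticeHNF
open Summit.HodgeConjecture.HodgeConjecture.Cruxes.H413.F0P3cDyRamDiagonalGluedTubeCriterion
open Summit.HodgeConjecture.HodgeConjecture.Cruxes.H413.F0P3cDyRamDiagonalGluedTubeCriterionTypeTwo
open Summit.HodgeConjecture.HodgeConjecture.Cruxes.H413.F0P3cDyRamDiagonalCoreHangingCriterion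
open Summit.HodgeConjecture.HodgeConjecture.Cruxes.H413.F0P3cDyRamDiagonalStrataDefs
open scoped Valued WithZero Matrix MatrixGroups

variable {K : Type*} [Field K] [Valued K ℤᵐ⁰]

/-! ## §1  `ϖ·G⁻¹` integral ⟺ the `(2,2)` cofactor lies in `𝔭` (given the shape of the other entries) -/

/-- **`ϖ·G⁻¹` IS INTEGRAL** for a `3 × 3` matrix `G` with `|det G| = |ϖ|²`, integral upper-left `2 × 2` block whose determinant lies in `𝔭` (`|ae − bd| ≤ |ϖ|`) and all other
entries in `𝔭 = ϖ𝒪`: every cofactor lies in `𝔭`, and `ϖ·G⁻¹ = (ϖ∕det G)·adj G` — ★ p09's `isIntMatrix_smul_inv_fin_three` with the rank-one identity relaxed to a valuation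
bound. [cite: Jacobowitz1962, §7] -/
theorem isIntMatrix_smul_inv_fin_three_of_le {ϖ a b c d e f g h i : K} (hϖ0 : ϖ ≠ 0) (hϖ1 : Valued.v ϖ ≤ 1)
    (hdet : Valued.v (!![a, b, c; d, e, f; g, h, i] : Matrix (Fin 3) (Fin 3) K).det = Valued.v ϖ ^ 2)
    (ha : Valued.v a ≤ 1) (hb : Valued.v b ≤ 1) (hd : Valued.v d ≤ 1) (he : Valued.v e ≤ 1)
    (hc : Valued.v c ≤ Valued.v ϖ) (hf : Valued.v f ≤ Valued.v ϖ) (hg : Valued.v g ≤ Valued.v ϖ) (hh : Valued.v h ≤ Valued.v ϖ) (hi : Valued.v i ≤ Valued.v ϖ)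
    (hcof : Valued.v (a * e - b * d) ≤ Valued.v ϖ) :
    IsIntMatrix (ϖ • (!![a, b, c; d, e, f; g, h, i] : Matrix (Fin 3) (Fin 3) K)⁻¹) := by
  set G : Matrix (Fin 3) (Fin 3) K := !![a, b, c; d, e, f; g, h, i] with hG
  have hvϖ : 0 < Valued.v ϖ := (Valuation.pos_iff _).2 hϖ0
  have hf1 : Valued.v f ≤ 1 := hf.trans hϖ1; have hg1 : Valued.v g ≤ 1 := hg.trans hϖ1; have hh1 : Valued.v h ≤ 1 := hh.trans hϖ1
  -- the nine cofactors lie in `𝔭`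
  have hadj : ∀ j k, Valued.v (G.adjugate j k) ≤ Valued.v ϖ := by
    intro j k
    rw [hG, Matrix.adjugate_fin_three_of]
    fin_cases j <;> fin_cases k <;>
      simp only [Matrix.of_apply, Matrix.cons_val', Matrix.cons_val_zero, Matrix.cons_val_one, Matrix.cons_val_two, Matrix.empty_val', Matrix.cons_val_fin_one,
        Matrix.tail_cons, Matrix.head_cons, Matrix.head_fin_const, Fin.isValue, Fin.mk_one, Fin.zero_eta, Fin.reduceFinMk]
    · exact v_sub_le_of_le (v_mul_le_of_le_one_of_le he hi) (v_mul_le_of_le_of_le_one hf hh1)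
    · exact v_neg_add_le (v_mul_le_of_le_one_of_le hb hi) (v_mul_le_of_le_of_le_one hc hh1)
    · exact v_sub_le_of_le (v_mul_le_of_le_one_of_le hb hf) (v_mul_le_of_le_of_le_one hc he)
    · exact v_neg_add_le (v_mul_le_of_le_one_of_le hd hi) (v_mul_le_of_le_of_le_one hf hg1)
    · exact v_sub_le_of_le (v_mul_le_of_le_one_of_le ha hi) (v_mul_le_of_le_of_le_one hc hg1)
    · exact v_neg_add_le (v_mul_le_of_le_one_of_le ha hf) (v_mul_le_of_le_of_le_one hc hd)
    · exact v_sub_le_of_le (v_mul_le_of_le_one_of_le hd hh) (v_mul_le_of_le_one_of_le he hg)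
    · exact v_neg_add_le (v_mul_le_of_le_one_of_le ha hh) (v_mul_le_of_le_one_of_le hb hg)
    · exact hcof
  have hdet0 : G.det ≠ 0 := fun h0 => by
    rw [h0, map_zero] at hdet; exact pow_ne_zero 2 hvϖ.ne' hdet.symm
  intro j k
  rw [Matrix.smul_apply, Matrix.inv_def, Ring.inverse_eq_inv, Matrix.smul_apply, smul_eq_mul, smul_eq_mul, map_mul, map_mul, map_inv₀, hdet]
  calc Valued.v ϖ * ((Valued.v ϖ ^ 2)⁻¹ * Valued.v (G.adjugate j k)) ≤ Valued.v ϖ * ((Valued.v ϖ ^ 2)⁻¹ * Valued.v ϖ) :=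
        mul_le_mul_right (mul_le_mul_right (hadj j k) _) _
    _ = (Valued.v ϖ * (Valued.v ϖ)⁻¹) * ((Valued.v ϖ)⁻¹ * Valued.v ϖ) := by rw [sq, mul_inv]; ac_rfl
    _ = 1 := by rw [mul_inv_cancel₀ hvϖ.ne', inv_mul_cancel₀ hvϖ.ne', one_mul]

/-- **CONVERSE: the `(2,2)` cofactor of `G` lies in `𝔭`** when `|det G| = |ϖ|²` and `ϖ·G⁻¹` is integral — because `(ϖ·G⁻¹)₂₂ = ϖ·(G₀₀G₁₁ − G₀₁G₁₀)∕det G`.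
This is the ONE binding type-2 condition beyond integrality on the core-hanging frame (the other eight cofactors carry a factor from `𝔭`). [cite: Jacobowitz1962, §7] -/
theorem v_cofactor_le_of_isIntMatrix_smul_inv {ϖ : K} (hϖ0 : ϖ ≠ 0) (G : Matrix (Fin 3) (Fin 3) K)
    (hdet : Valued.v G.det = Valued.v ϖ ^ 2) (hinv : IsIntMatrix (ϖ • G⁻¹)) :
    Valued.v (G 0 0 * G 1 1 - G 0 1 * G 1 0) ≤ Valued.v ϖ := by
  have hvϖ : 0 < Valued.v ϖ := (Valuation.pos_iff _).2 hϖ0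
  have h := hinv 2 2
  rw [Matrix.smul_apply, Matrix.inv_def, Ring.inverse_eq_inv, Matrix.smul_apply, smul_eq_mul, smul_eq_mul, map_mul, map_mul, map_inv₀, hdet,
    Matrix.adjugate_fin_three] at h
  simp only [Matrix.of_apply, Matrix.cons_val', Matrix.cons_val_two, Matrix.empty_val', Matrix.cons_val_fin_one, Matrix.tail_cons, Matrix.head_cons,
    Matrix.head_fin_const, Fin.isValue] at h
  have e : Valued.v ϖ * ((Valued.v ϖ ^ 2)⁻¹ * Valued.v (G 0 0 * G 1 1 - G 0 1 * G 1 0)) =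
      Valued.v (G 0 0 * G 1 1 - G 0 1 * G 1 0) * (Valued.v ϖ)⁻¹ := by
    rw [sq, mul_inv, ← mul_assoc, ← mul_assoc, mul_inv_cancel₀ hvϖ.ne', one_mul, mul_comm]
  rw [e, mul_inv_le_iff₀ hvϖ, one_mul] at h
  exact h

/-! ## §2  Necessity: the letters of a type-2 polarisation -/

/-- A `σ`-FIXED element squeezed between `|ϖ|^{−2ρ}` and `|ϖ|^{−2ρ−1}` has valuation `|ϖ|^{−2ρ}` when fixed elements have EVEN valuation and `|ϖ| = exp(−1)` (ramified datum).
[cite: Serre1980Trees, Ch. II §1.1] -/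
theorem v_eq_of_fixed_of_bounds {σ : K →+* K} (hfix : ∀ x : K, σ x = x → x ≠ 0 → ∃ n : ℤ, Valued.v x = WithZero.exp (2 * n))
    {ϖ : K} (hϖ : Valued.v ϖ = WithZero.exp (-1 : ℤ)) (ρ : ℕ) {P : K} (hσP : σ P = P) (hP0 : P ≠ 0)
    (hlo : (Valued.v ϖ ^ (2 * ρ))⁻¹ ≤ Valued.v P) (hhi : Valued.v P * Valued.v ϖ ^ (2 * ρ + 1) ≤ 1) :
    Valued.v P = (Valued.v ϖ ^ (2 * ρ))⁻¹ := by
  obtain ⟨n, hn⟩ := hfix P hσP hP0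
  rw [v_pow_eq_exp_neg hϖ, ← WithZero.exp_neg, neg_neg] at hlo ⊢
  rw [v_pow_eq_exp_neg hϖ, hn, ← WithZero.exp_add, ← WithZero.exp_zero, WithZero.exp_le_exp] at hhi
  rw [hn, WithZero.exp_le_exp] at hlo
  rw [hn]
  congr 1
  push_cast at hlo hhi ⊢
  omega

/-- **NECESSITY — THE LETTERS OF A TYPE-2 POLARISATION OF THE CORE-HANGING FRAME.**  If `latt V`, `V = (1 0 0; x ϖ^ρ 0; xζ+y″ ϖ^ρζ ϖ^{2ρ+1})` (`|x|, |ζ| ≤ 1`,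
`y = xζ + y″` a unit), is a type-2 vertex lattice of the non-degenerate `σ`-fixed diagonal form `diag D`, then with `f := −(D₁ + D₂Nζ)∕D₂` and `g := (D₀ + Nx·D₁ + Ny·D₂)∕D₂`:
(a) `|D₂|⁻¹ ≤ |ϖ|^{2ρ}` (`ϖ·D₂⁻¹e₃ ∈ ϖM^♯ ⊆ M` lies on the axis `𝔭^{2ρ+1}e₃`); (b) `|D₂|·|ϖ|^{2ρ+1} ≤ 1` (the Gram entry `G₀₂ = σy·D₂·ϖ^{2ρ+1}`); (R) `|ζσy″ − σx·f| ≤ |ϖ|^ρ` (the Gram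
entry `G₀₁ = ϖ^ρ·D₂·(ζσy″ − σx·f)`); (COF) `|f·g + (ζσy″ − σx·f)(σζ·y″ − x·f)| ≤ |ϖ|^{2ρ+1}` (§1: the `(2,2)` cofactor `−π₀^ρD₂²·(fg + BσB)` lies in `𝔭`).
[cite: Jacobowitz1962, §7] [cite: Kottwitz1986BaseChangeUnits, §1 pp. 240–241] -/
theorem letters_of_isVertexLattice_two_latt_coreHanging {σ : K →+* K} (hσ : ∀ a, σ (σ a) = a) (hvσ : ∀ a, Valued.v (σ a) = Valued.v a)
    {ϖ : K} (hϖ0 : ϖ ≠ 0) (hϖ1 : Valued.v ϖ ≤ 1) (ρ : ℕ) {x ζ y'' : K} (hx : Valued.v x ≤ 1) (hζ : Valued.v ζ ≤ 1) (hy : Valued.v (x * ζ + y'') = 1)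
    (V : GL (Fin 3) K) (hV : (V : Matrix (Fin 3) (Fin 3) K) = !![1, 0, 0; x, ϖ ^ ρ, 0; x * ζ + y'', ϖ ^ ρ * ζ, ϖ ^ (2 * ρ + 1)])
    {D : Fin 3 → K} (hD : ∀ i, σ (D i) = D i ∧ D i ≠ 0) (hvert : IsVertexLattice σ ϖ (Matrix.diagonal D) 2 (latt (V : Matrix (Fin 3) (Fin 3) K)))
    {f g : K} (hf : f = -(D 1 + D 2 * (ζ * σ ζ)) / D 2) (hg : g = (D 0 + σ x * D 1 * x + σ (x * ζ + y'') * D 2 * (x * ζ + y'')) / D 2) :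
    (Valued.v ϖ ^ (2 * ρ))⁻¹ ≤ Valued.v (D 2) ∧ Valued.v (D 2) * Valued.v ϖ ^ (2 * ρ + 1) ≤ 1 ∧ σ f = f ∧ σ g = g ∧
      Valued.v (ζ * σ y'' - σ x * f) ≤ Valued.v ϖ ^ ρ ∧
      Valued.v (f * g + (ζ * σ y'' - σ x * f) * (σ ζ * y'' - x * f)) ≤ Valued.v ϖ ^ (2 * ρ + 1) := by
  set c : ℕ := 2 * ρ + 1 with hc
  have hvϖ : 0 < Valued.v ϖ := (Valuation.pos_iff _).2 hϖ0
  have hpc : (ϖ ^ ρ : K) ≠ 0 := pow_ne_zero _ hϖ0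
  have hrc : (ϖ ^ c : K) ≠ 0 := pow_ne_zero _ hϖ0
  have hD2 : D 2 ≠ 0 := (hD 2).2
  have hD2pos : 0 < Valued.v (D 2) := (Valuation.pos_iff _).2 hD2
  have hdetD : IsUnit (Matrix.diagonal D).det := by
    rw [Matrix.det_diagonal, Fin.prod_univ_three]
    exact (mul_ne_zero (mul_ne_zero (hD 0).2 (hD 1).2) hD2).isUnit
  set y : K := x * ζ + y'' with hydef
  -- fixedness of the letters
  have hσf : σ f = f := by
    rw [hf, map_div₀, map_neg, map_add, map_mul, map_mul, hσ, (hD 1).1, (hD 2).1, mul_comm (σ ζ) ζ]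
  have hσg : σ g = g := by
    rw [hg, map_div₀, map_add, map_add, map_mul, map_mul, map_mul, map_mul, hσ, hσ, (hD 0).1, (hD 1).1, (hD 2).1]
    congr 1; ring
  -- the lattice is integral
  have hvy : Valued.v y ≤ 1 := hy.le
  have hint : ∀ m ∈ latt (V : Matrix (Fin 3) (Fin 3) K), ∀ i, Valued.v (m i) ≤ 1 := by
    intro m hm i
    rw [hV] at hm
    have hle := latt_hnf_le_stdLattice (x := x) (y := y) (z := ϖ ^ ρ * ζ) (p := ϖ ^ ρ) (r := ϖ ^ c) hx hvy
      (by rw [map_mul, map_pow]; exact mul_le_one' (pow_le_one' hϖ1 _) hζ) (by rw [map_pow]; exact pow_le_one' hϖ1 _) (by rw [map_pow]; exact pow_le_one' hϖ1 _)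
    exact (mem_stdLattice.1 (hle hm)) i
  -- (a) `ϖ·D₂⁻¹ e₃ ∈ ϖM^♯ ⊆ M` lies on the axis `𝔭^{2ρ+1} e₃`
  have hw' : Pi.single (2 : Fin 3) (D 2)⁻¹ ∈ dualLatt σ (Matrix.diagonal D) (latt (V : Matrix (Fin 3) (Fin 3) K)) := by
    rw [mem_dualLatt]
    intro m hm
    rw [pairing_apply]
    have hsum : ∑ i : Fin 3, ∑ j : Fin 3, σ (m i) * Matrix.diagonal D i j * (Pi.single (2 : Fin 3) (D 2)⁻¹ : Fin 3 → K) j = σ (m 2) := by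
      simp [Matrix.diagonal, Pi.single_apply, hD2]
    rw [hsum, hvσ]
    exact hint m hm 2
  have hw : Pi.single (2 : Fin 3) (ϖ * (D 2)⁻¹) ∈ latt (V : Matrix (Fin 3) (Fin 3) K) := by
    refine scaleLattice_dualLatt_le_of_isVertexLattice hvσ hdetD hvert ((mem_scaleLattice_iff hϖ0 _ _).2 ?_)
    rwa [← smul_eq_mul, Pi.single_smul', smul_smul, inv_mul_cancel₀ hϖ0, one_smul]
  have ha : (Valued.v ϖ ^ (2 * ρ))⁻¹ ≤ Valued.v (D 2) := by
    rw [hV] at hw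
    have h := (single_two_mem_latt_hnf_iff x y (ϖ ^ ρ * ζ) hpc hrc _).1 hw
    rw [map_mul, map_pow, hc, pow_succ, mul_comm (Valued.v ϖ ^ (2 * ρ)) (Valued.v ϖ)] at h
    have h' : Valued.v (D 2)⁻¹ ≤ Valued.v ϖ ^ (2 * ρ) := le_of_mul_le_mul_left h hvϖ
    rw [map_inv₀] at h'
    exact inv_le_of_inv_le₀ hD2pos h'
  -- the Gram matrix
  obtain ⟨hG, hGinv, hGdet⟩ := (isVertexLattice_latt_iff_of_v σ hvσ hϖ0 (Matrix.diagonal D) 2 V).1 hvert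
  have hGe := formCongr_hnf_diagonal σ D x y (ϖ ^ ρ * ζ) (ϖ ^ ρ) (ϖ ^ c) V hV
  -- (b) the entry `G₀₂ = σy·D₂·ϖ^{2ρ+1}`
  have hb : Valued.v (D 2) * Valued.v ϖ ^ (2 * ρ + 1) ≤ 1 := by
    have h02 := hG 0 2
    rw [hGe] at h02
    simp only [Matrix.of_apply, Matrix.cons_val', Matrix.cons_val_zero, Matrix.cons_val_two, Matrix.empty_val', Matrix.cons_val_fin_one, Matrix.tail_cons,
      Matrix.head_cons, Fin.isValue] at h02
    rw [map_mul, map_mul, hvσ, hy, one_mul, map_pow, hc] at h02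
    exact h02
  -- (R) the entry `G₀₁ = ϖ^ρ·D₂·(ζσy″ − σx·f)`
  have hR : Valued.v (ζ * σ y'' - σ x * f) ≤ Valued.v ϖ ^ ρ := by
    have h01 := hG 0 1
    rw [hGe] at h01
    simp only [Matrix.of_apply, Matrix.cons_val', Matrix.cons_val_zero, Matrix.cons_val_one, Matrix.empty_val', Matrix.cons_val_fin_one, Fin.isValue] at h01
    have hrew : σ x * D 1 * ϖ ^ ρ + σ y * D 2 * (ϖ ^ ρ * ζ) = ϖ ^ ρ * D 2 * (ζ * σ y'' - σ x * f) := by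
      rw [hydef, hf, map_add, map_mul]; field_simp; ring
    rw [hrew, map_mul, map_mul, map_pow] at h01
    have hϖρpos : 0 < Valued.v ϖ ^ ρ := pow_pos hvϖ _
    have key : Valued.v (ζ * σ y'' - σ x * f) ≤ (Valued.v ϖ ^ ρ * Valued.v (D 2))⁻¹ := by
      rw [← one_mul (Valued.v ϖ ^ ρ * Valued.v (D 2))⁻¹, le_mul_inv_iff₀ (mul_pos hϖρpos hD2pos)]
      calc Valued.v (ζ * σ y'' - σ x * f) * (Valued.v ϖ ^ ρ * Valued.v (D 2))
          = Valued.v ϖ ^ ρ * Valued.v (D 2) * Valued.v (ζ * σ y'' - σ x * f) := mul_comm _ _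
        _ ≤ 1 := h01
    refine key.trans ?_
    rw [mul_inv]
    have ha' : (Valued.v (D 2))⁻¹ ≤ Valued.v ϖ ^ (2 * ρ) := inv_le_of_inv_le₀ (pow_pos hvϖ _) ha
    calc (Valued.v ϖ ^ ρ)⁻¹ * (Valued.v (D 2))⁻¹ ≤ (Valued.v ϖ ^ ρ)⁻¹ * Valued.v ϖ ^ (2 * ρ) := mul_le_mul_right ha' _
      _ = Valued.v ϖ ^ ρ := by rw [show 2 * ρ = ρ + ρ by ring, pow_add, inv_mul_cancel_left₀ hϖρpos.ne']
  -- (COF) the `(2,2)` cofactor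
  have hcof : Valued.v (f * g + (ζ * σ y'' - σ x * f) * (σ ζ * y'' - x * f)) ≤ Valued.v ϖ ^ (2 * ρ + 1) := by
    have h := v_cofactor_le_of_isIntMatrix_smul_inv hϖ0 _ hGdet hGinv
    rw [hGe] at h
    simp only [Matrix.of_apply, Matrix.cons_val', Matrix.cons_val_zero, Matrix.cons_val_one, Matrix.empty_val', Matrix.cons_val_fin_one, Fin.isValue] at h
    have hrew : (D 0 + σ x * D 1 * x + σ y * D 2 * y) * (σ (ϖ ^ ρ) * D 1 * ϖ ^ ρ + σ (ϖ ^ ρ * ζ) * D 2 * (ϖ ^ ρ * ζ)) -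
        (σ x * D 1 * ϖ ^ ρ + σ y * D 2 * (ϖ ^ ρ * ζ)) * (σ (ϖ ^ ρ) * D 1 * x + σ (ϖ ^ ρ * ζ) * D 2 * y) =
        -((ϖ * σ ϖ) ^ ρ * (D 2) ^ 2 * (f * g + (ζ * σ y'' - σ x * f) * (σ ζ * y'' - x * f))) := by
      rw [hydef, hf, hg, map_add, map_mul, map_mul, map_pow, mul_pow]; field_simp; ring
    rw [hrew, Valuation.map_neg, map_mul, map_mul, map_pow, map_mul, hvσ, ← sq, ← pow_mul, map_pow] at h
    -- `|ϖ|^{2ρ}·|D₂|²·X ≤ |ϖ|` with `|D₂| ≥ |ϖ|^{−2ρ}`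
    have hD2sq : (Valued.v ϖ ^ (2 * ρ))⁻¹ * (Valued.v ϖ ^ (2 * ρ))⁻¹ ≤ Valued.v (D 2) ^ 2 := by rw [sq]; exact mul_le_mul' ha ha
    have hpos : 0 < Valued.v ϖ ^ (2 * ρ) * Valued.v (D 2) ^ 2 := mul_pos (pow_pos hvϖ _) (pow_pos hD2pos _)
    have hlow : (Valued.v ϖ ^ (2 * ρ))⁻¹ ≤ Valued.v ϖ ^ (2 * ρ) * Valued.v (D 2) ^ 2 :=
      calc (Valued.v ϖ ^ (2 * ρ))⁻¹ = Valued.v ϖ ^ (2 * ρ) * ((Valued.v ϖ ^ (2 * ρ))⁻¹ * (Valued.v ϖ ^ (2 * ρ))⁻¹) := by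
            rw [← mul_assoc, mul_inv_cancel₀ (pow_ne_zero _ hvϖ.ne'), one_mul]
        _ ≤ Valued.v ϖ ^ (2 * ρ) * Valued.v (D 2) ^ 2 := mul_le_mul_right hD2sq _
    have h' : (Valued.v ϖ ^ (2 * ρ))⁻¹ * Valued.v (f * g + (ζ * σ y'' - σ x * f) * (σ ζ * y'' - x * f)) ≤ Valued.v ϖ :=
      (mul_le_mul_left hlow _).trans h
    rw [inv_mul_le_iff₀ (pow_pos hvϖ _), ← pow_succ] at h'
    exact h'
  exact ⟨ha, hb, hσf, hσg, hR, hcof⟩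


end Summit.HodgeConjecture.HodgeConjecture.Cruxes.H413.F0P3cDyRamDiagonalCoreHangingPolarisationsTypeTwo

end
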